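import Summits.FinalStateConjecture.FinalStateConjecture.Theses.LaminatedThreshold
import Summits.FinalStateConjecture.FinalStateConjecture.Theorems.LaminatedThresholdAssemblyFrame

/-!
# Route LaminatedThreshold · crux `LaminatedThreshold` (stmt-FinalStateConjecture-16893) — the two ends of the crux, by name

Two support lemmas about the crux decl
`Summit.FinalStateConjecture.FinalStateConjecture.Theses.LaminatedThreshold.LaminatedThreshold` stated BY
NAME (this module imports the route file; it closes nothing, so no cycle can arise), complementing the
Φ-free analysis of `LaminatedThresholdAssemblyFrame` (`laminatedThreshold_iff_dropBad`,
`laminatedThreshold_of_fatLocal`, `real_lamination`, `noLocalExitWindow_of_laminatedThreshold`), which is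
stated over the inlined body:

* `laminatedThreshold_of_fat` (registered sub-goal of the item) — the POINTWISE fat case: one admissible
  vacuum datum `d⋆` such that EVERY admissible datum agreeing with `d⋆` outside a compact set is
  exceptional already gives the crux (`Φ ≡ 0`, `K = univ`, `δ = 1`; no family calculus at all). Its
  hypothesis — an exhibited smooth, complete, one-ended asymptotically flat vacuum datum PROVED exceptional
  together with all its compactly supported admissible deformations — is the open content of the crux in
  its simplest form (no such datum is known; prover census 2026-08-17).
* `not_laminatedThreshold_of_localExits` — the route's KILL CRITERION in the form a refuter needs
  (`¬ LaminatedThreshold` by name): local curve-genericity at every exceptional admissible datum — a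
  jointly smooth admissible compactly supported one-parameter family through it whose members with
  `0 < ‖c‖ < ε` are all good — refutes the crux (contrapositive of
  `noLocalExitWindow_of_laminatedThreshold`).

"Good" is the summit's per-datum property, `(∃ MGHD) ∧ ∀ MGHD, SettlesT2` (`ClusterCompleteness.SettlesT2`,
verbatim the re-typed matrix), expanded in full inside the registered header. References: Christodoulou,
CQG 16 (1999) A23, p. A24; Dafermos–Luk, arXiv:1710.01722, Conjecture 1.
-/

-- every `Summit.FinalStateConjecture.FinalStateConjecture.…` name repeats the summit = sub-problem segment (D-0017 layout)
set_option linter.dupNamespace false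

noncomputable section

open Set Filter Metric
open scoped Manifold ContDiff Topology
open Literature.Geometry.Lorentzian
open Summit.FinalStateConjecture.FinalStateConjecture.Theorems.ClusterCompleteness (SettlesT2)

namespace Summit.FinalStateConjecture.FinalStateConjecture.Theorems.LaminatedThreshold

/-- **Pointwise-fat exceptional data give the crux** (registered sub-goal `laminatedThreshold_of_fat` of
item stmt-FinalStateConjecture-16893). If some admissible vacuum datum `d⋆` on some connected Hausdorff
second-countable smooth `3`-manifold is such that every admissible datum agreeing with `d⋆` outside a
compact set is exceptional (not: an MGHD exists and every MGHD has complete sojourn-`𝓘⁺` and a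
sub-extremal, ray-closed, exhaustive, future-oriented Kerr decomposition), then `LaminatedThreshold`
holds with `Φ ≡ 0`, `K = univ`, `δ = 1`: `d⋆` itself is exceptional (empty compact set), `univ`
accumulates two-sidedly at `0`, a constant function is continuous, and every member of a local family
agrees with `d⋆` off the family's compact set. [folklore] -/
theorem laminatedThreshold_of_fat : (∃ (X : Type) (_ : TopologicalSpace X) (_ : ChartedSpace Literature.Geometry.Lorentzian.E3 X) (_ : IsManifold (𝓡 3) ((⊤ : ℕ∞) : WithTop ℕ∞) X) (_ : T2Space X) (_ : SecondCountableTopology X) (_ : ConnectedSpace X) (dstar : Literature.Geometry.Lorentzian.InitialDataSet (𝓡 3) X), dstar ∈ Literature.Geometry.Lorentzian.admissibleVacuumData X ∧ ∀ D ∈ Literature.Geometry.Lorentzian.admissibleVacuumData X, (∃ C : Set X, IsCompact C ∧ ∀ x ∉ C, D.h.inner x = dstar.h.inner x ∧ D.k x = dstar.k x) → ¬ ((∃ 𝒟 : Literature.Geometry.Lorentzian.VacuumCauchyDevelopment D, 𝒟.IsMaximal) ∧ ∀ 𝒟 : Literature.Geometry.Lorentzian.VacuumCauchyDevelopment D, 𝒟.IsMaximal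 → Summit.FinalStateConjecture.HasCompleteNullInfinity 𝒟.toCauchyDevelopment ∧ ∃ (O : Set 𝒟.carrier) (d : Literature.Geometry.Lorentzian.FinalStateDecomposition 𝒟.toSpacetime O 2), (∀ i, Literature.Geometry.Lorentzian.Kerr.IsSubextremal (d.mass i) (d.spin i)) ∧ O = Summit.FinalStateConjecture.exteriorOf 𝒟.toCauchyDevelopment d.charted ∧ Summit.FinalStateConjecture.RaysStayInClosure 𝒟.toCauchyDevelopment O ∧ Summit.FinalStateConjecture.HasExhaustiveCharts d ∧ Summit.FinalStateConjecture.IsFutureOriented d)) → Summit.FinalStateConjecture.FinalStateConjecture.Theses.LaminatedThreshold.LaminatedThreshold := by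
  rintro ⟨X, i₁, i₂, i₃, i₄, i₅, i₆, dstar, hadm, hfat⟩
  refine ⟨X, i₁, i₂, i₃, i₄, i₅, i₆, dstar, fun _ ↦ 0, univ, hadm, ?_, mem_univ _, ?_, ?_⟩
  · exact hfat dstar hadm ⟨∅, isCompact_empty, fun _ _ ↦ ⟨rfl, rfl⟩⟩
  · intro ε hε
    exact ⟨⟨-(ε / 2), mem_univ _, by linarith, by linarith⟩,
      ⟨ε / 2, mem_univ _, by linarith, by linarith⟩⟩
  · intro F _ _ hadmF hC
    refine ⟨1, one_pos, continuousOn_const, fun c _ _ ↦ ?_⟩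
    obtain ⟨C, hCc, hagree⟩ := hC
    exact hfat (F c) (hadmF c) ⟨C, hCc, hagree c⟩

/-- **The route's kill criterion, by name.** If at EVERY admissible exceptional datum of every connected
Hausdorff second-countable smooth `3`-manifold there is a LOCAL EXIT WITH A WINDOW — a jointly smooth
one-parameter family of admissible data through the datum, agreeing with it outside one compact set, all
of whose members with `0 < ‖c‖ < ε` are good — then the crux `LaminatedThreshold` is false: its witness
datum would be an admissible exceptional datum with no local exit window
(`noLocalExitWindow_of_laminatedThreshold`). This hypothesis ("local curve-genericity at every exceptional
datum") is the positive routes' shared hidden lemma; landing it closes the item `refuted`. [folklore] -/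
theorem not_laminatedThreshold_of_localExits
    (h : ∀ (X : Type) [TopologicalSpace X] [ChartedSpace E3 X] [IsManifold (𝓡 3) ∞ X]
      [T2Space X] [SecondCountableTopology X] [ConnectedSpace X],
      ∀ dstar ∈ admissibleVacuumData X,
        ¬ ((∃ 𝒟 : VacuumCauchyDevelopment dstar, 𝒟.IsMaximal) ∧
            ∀ 𝒟 : VacuumCauchyDevelopment dstar, 𝒟.IsMaximal → SettlesT2 𝒟) →
          ∃ F : EuclideanSpace ℝ (Fin 1) → InitialDataSet (𝓡 3) X,
            InitialDataSet.IsSmoothDataFamily 1 F ∧ F 0 = dstar ∧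
              (∀ c, F c ∈ admissibleVacuumData X) ∧
                (∃ C : Set X, IsCompact C ∧
                  ∀ c, ∀ x ∉ C, (F c).h.inner x = dstar.h.inner x ∧ (F c).k x = dstar.k x) ∧
                  ∃ ε : ℝ, 0 < ε ∧ ∀ c : EuclideanSpace ℝ (Fin 1), c ≠ 0 → ‖c‖ < ε →
                    ((∃ 𝒟 : VacuumCauchyDevelopment (F c), 𝒟.IsMaximal) ∧
                      ∀ 𝒟 : VacuumCauchyDevelopment (F c), 𝒟.IsMaximal → SettlesT2 𝒟)) :
    ¬ Theses.LaminatedThreshold.LaminatedThreshold := by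
  intro hLT
  obtain ⟨X, i₁, i₂, i₃, i₄, i₅, i₆, dstar, hadm, hbad, hno⟩ :=
    noLocalExitWindow_of_laminatedThreshold hLT
  obtain ⟨F, hF, h0, hadmF, hC, ε, hε, hgood⟩ := h X dstar hadm hbad
  obtain ⟨c, hc0, hcε, hcbad⟩ := hno F hF h0 hadmF hC ε hε
  exact hcbad (hgood c hc0 hcε)

end Summit.FinalStateConjecture.FinalStateConjecture.Theorems.LaminatedThreshold

end
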